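import Mathlib
import Literature.NumberTheory.LFunctions.Zhang2022.Section17U023Chi
import Literature.NumberTheory.LFunctions.Zhang2022.Section17Step17u025
import Literature.NumberTheory.LFunctions.Zhang2022.TypedSection17RelSubsteps
import Literature.NumberTheory.LFunctions.Zhang2022.TypedSection17RelE
import HarnessLib

/-!
# Zhang (2022) §17, the `I₄⁻` chain in the χ-twisted reading of record (RT16-int-1):
# u023-χ from Lemma 15.1 (χ) + the weight swap, u024-χ, u026, and (17.9)/(17.9)ᴿ from its parts

Topic `Literature/NumberTheory/LFunctions/Zhang2022` (Landau–Siegel audit tree; verdict-neutral).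
Y. Zhang, *Discrete mean estimates and the Landau–Siegel zero*, arXiv:2211.02515v1 (2022)
[Zhang2022LandauSiegel] — **an unrefereed manuscript under adjudication**; the displays are CLAIM nodes
of `Typed.Section17`, stated not asserted; nothing here bears on Theorems 1–2. §17 pp. 97–98 (tex
L4797–L4850; DAG `Z22:(17.8)`, `Z22:§17.u021`, `Z22:§17.u023`, `Z22:§17.u024`, `Z22:§17.u026`, `Z22:(17.9)`).

READING OF RECORD (WP16-PLAN §1.6, RT16-int-1; cell rows G-L4t1-1, G-L4t6-1/1a, N-19): since
`B(s,ψ) = Σ b(n)ψχ(n)n^{−s}` (15.1), the `ψ`-coefficients of `B·G·N(s+β₂)·N(s+β₃)` are `(bχ) ∗ ν₁*`, not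
the literal χ-free `Typed.Section17.bConvNuOne = b ∗ ν₁*` printed from §17.u015 on; the literal nodes
`Step17_u015/Eq17_8/Step17_u019–u021/u023/u024` are therefore never prover targets (u023 literal is the
refuted N-19), and the χ-twisted displays are spelled INLINE below (no new `def … : Prop`, R1):
`V_χ := Σ_n ((bχ)∗ν₁*)(n)ϱ*(n)/n` with `LSeries.convolution (fun n => bcoef D n * χ n) (nuOneStar c′ χ)`,
and in u021/u023 the summand `b(l₁m₁)χ(l₁m₁)…`. The right-hand sides of u023/u024 are the PRINTED ones
(the twist contributes exactly the printed `χ(l₁)`), so `Step17_u025`, `Step17_u026`, `Eq17_7`, `Eq17_9`,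
`Eq17_9Rel` are unaffected and are concluded BY NAME.

PROVED here (theorems only; u023-χ is the companion `Section17U023Chi`,
`step17_u023Chi_of_lemma151Chi`, from `Skeleton.Lemma151Chi c′` — HYPOTHESIS BY NAME, App. B cone, WP15 —
and the tree's weight swap `Skeleton.swap17_bound`):
* `step17_u024Chi_of` — u024-χ (ABSOLUTE `o(1)`): from u021-χ (hypothesis, inline), u023-χ and the
  summed-error estimate `step17_hE_holds` (`Section17SummedError`, row G-d58-1 — which turned out to hold
  absolutely, so no relative budget is needed here); the bookkeeping is the tree's `step17_u024_of` re-run;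
* `step17_u026_of_chi` — u026 (`Φ₃⁻(p) = 𝔢₁𝔞p + o(p)`, typed node BY NAME) from (17.8)-χ (hypothesis,
  inline), u024-χ and `Step17_u025` (the tree theorem `step17_u025_holds`, `Section17Step17u025`);
* `eq17_9_of_partsChi`, `eq17_9Rel_of_partsChi` — (17.9) and the v19 LEAF `Eq17_9Rel c′` BY NAME from
  `Eq17_7 c′` + (17.8)-χ + u021-χ + `Lemma151Chi c′` (tree edges `eq17_9_of`, `eq17_9Rel_of_eq17_9`);
* `step17_u024ChiRel_of_lemma151Chi`, `eq17_9Rel_of_partsChiRel` — the RELATIVE-budget signatures of the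
  planner's sketch (WP16-PLAN S4), as corollaries (`ε ≤ ε(𝔞+1)`).

So the leaf h17_9 is REDUCED to: `Eq17_7` ((17.7): u011 + the shift `𝔍(−α) → 𝔍(−1)` + the `Ψ₁ → Ψ`
extension), (17.8)-χ (the (17.3)-mirror for `Φ₃⁻(p)`), u021-χ (dropping `m₂ > 1` / `(m₁,𝔮) > 1`), and
`Skeleton.Lemma151Chi` (App. B). WHAT THIS IS NOT: a proof of any of those four; any claim about Theorems
1–2 of the source or about Landau–Siegel zeros; nothing here bears on the cell's verdict on (8.24).

## References

* Y. Zhang, arXiv:2211.02515v1 (2022), §17 pp. 97–98 ((17.8), u021–u026, (17.9)); §15 (15.1),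
  Lemma 15.1 p. 86; App. B (B.1) p. 106. [cite: Zhang2022LandauSiegel, §17 (17.9) p.98]
-/

noncomputable section

open Complex Real Finset
open Literature.NumberTheory.LFunctions.Zhang2022.Skeleton
open Literature.NumberTheory.LFunctions.Zhang2022.Typed.Section17

namespace Literature.NumberTheory.LFunctions.Zhang2022.Phi3Eval

/-! ## §2. u024 in the χ-reading: u021-χ + u023-χ + the summed error (G-d58-1, proved) -/

/-- **§17.u024 in the χ-reading of record, ABSOLUTE form**: from u021-χ (hypothesis, spelled inline
with `b(l₁m₁)χ(l₁m₁)` and `V_χ = Σ_n ((bχ)∗ν₁*)(n)ϱ*(n)/n`), u023-χ (`step17_u023Chi_of_lemma151Chi`,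
from `Lemma151Chi c′`) and the summed-error estimate `step17_hE_holds` (`Section17SummedError`;
row G-d58-1): `V_χ = 𝔢₁ Σ_{l<D⁴}(ν(l)/l)Σ_{l=l₁l₂}χ(l₁)τ₂(l₁)ν₁*(l₂) + o(1)`. The bookkeeping is the
tree's `step17_u024_of`, re-run verbatim. [cite: Zhang2022LandauSiegel, §17 u024 p.98] -/
theorem step17_u024Chi_of (c' : ℝ)
    (h21 : ∀ ε : ℝ, 0 < ε → ForAllLarge fun D _ χ => AssumptionA D χ →
      ‖(∑' n : ℕ, LSeries.convolution (fun n => bcoef D n * χ (n : ZMod D)) (nuOneStar c' χ) n *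
            varrho17 c' χ n / (n : ℂ)) -
          ∑ l ∈ Finset.Ico 1 (D ^ 4), nu χ l / (l : ℂ) *
            ∑ q ∈ l.divisorsAntidiagonal, ∑' m₁ : ℕ,
              if Nat.Coprime m₁ (frakq D) then
                bcoef D (q.1 * m₁) * χ ((q.1 * m₁ : ℕ) : ZMod D) * nuOneStar c' χ q.2 *
                  kappa2bar c' D m₁ / (m₁ : ℂ)
              else 0‖ ≤ ε)
    (h151 : Lemma151Chi c') :
    ∀ ε : ℝ, 0 < ε → ForAllLarge fun D _ χ => AssumptionA D χ →
      ‖(∑' n : ℕ, LSeries.convolution (fun n => bcoef D n * χ (n : ZMod D)) (nuOneStar c' χ) n *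
            varrho17 c' χ n / (n : ℂ)) -
          frake 1 * ∑ l ∈ Finset.Ico 1 (D ^ 4), nu χ l / (l : ℂ) *
            ∑ q ∈ l.divisorsAntidiagonal,
              χ (q.1 : ZMod D) * (q.1.divisors.card : ℂ) * nuOneStar c' χ q.2‖ ≤ ε := by
  intro ε hε
  obtain ⟨C, hC⟩ := step17_u023Chi_of_lemma151Chi c' h151
  have hε2 : 0 < ε / 2 := by positivity
  have hδ : 0 < ε / 2 / (|C| + 1) := by positivity
  obtain ⟨D₀, h⟩ := ((h21 _ hε2).and hC).and (step17_hE_holds c' _ hδ)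
  refine ⟨D₀, fun D _ χ hD hq hp hA => ?_⟩
  obtain ⟨⟨e21, e23⟩, eE⟩ := h D χ hD hq hp
  replace e21 := e21 hA
  replace e23 := e23 hA
  replace eE := eE hA
  -- names
  set V : ℂ := ∑' n : ℕ, LSeries.convolution (fun n => bcoef D n * χ (n : ZMod D)) (nuOneStar c' χ) n *
    varrho17 c' χ n / (n : ℂ) with hV
  set inner : ℕ → ℂ := fun l₁ => ∑' m₁ : ℕ,
    if Nat.Coprime m₁ (frakq D) then
      bcoef D (l₁ * m₁) * χ ((l₁ * m₁ : ℕ) : ZMod D) * kappa2bar c' D m₁ / (m₁ : ℂ) else 0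
    with hinner
  set U : ℂ := ∑ l ∈ Finset.Ico 1 (D ^ 4), nu χ l / (l : ℂ) *
    ∑ q ∈ l.divisorsAntidiagonal, ∑' m₁ : ℕ,
      if Nat.Coprime m₁ (frakq D) then
        bcoef D (q.1 * m₁) * χ ((q.1 * m₁ : ℕ) : ZMod D) * nuOneStar c' χ q.2 *
          kappa2bar c' D m₁ / (m₁ : ℂ) else 0 with hU
  set W : ℂ := ∑ l ∈ Finset.Ico 1 (D ^ 4), nu χ l / (l : ℂ) *
    ∑ q ∈ l.divisorsAntidiagonal, χ (q.1 : ZMod D) * (q.1.divisors.card : ℂ) * nuOneStar c' χ q.2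
    with hW
  set E : ℝ := ∑ l ∈ Finset.Ico 1 (D ^ 4), ‖nu χ l‖ / l *
    ∑ q ∈ l.divisorsAntidiagonal, (q.1.divisors.card : ℝ) * ‖nuOneStar c' χ q.2‖ with hEdef
  -- pull `ν₁*(l₂)` out of the inner series
  have hpull : ∀ l₁ l₂ : ℕ, (∑' m₁ : ℕ, if Nat.Coprime m₁ (frakq D) then
      bcoef D (l₁ * m₁) * χ ((l₁ * m₁ : ℕ) : ZMod D) * nuOneStar c' χ l₂ * kappa2bar c' D m₁ / (m₁ : ℂ)
      else 0) = nuOneStar c' χ l₂ * inner l₁ := by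
    intro l₁ l₂
    rw [hinner]
    simp only
    rw [← tsum_mul_left]
    refine tsum_congr fun m₁ => ?_
    split_ifs
    · ring
    · simp
  have hU' : U = ∑ l ∈ Finset.Ico 1 (D ^ 4), nu χ l / (l : ℂ) *
      ∑ q ∈ l.divisorsAntidiagonal, nuOneStar c' χ q.2 * inner q.1 := by
    rw [hU]
    refine Finset.sum_congr rfl fun l _ => ?_
    congr 1
    exact Finset.sum_congr rfl fun q _ => hpull q.1 q.2
  -- the termwise substitution of u023-χ
  have hdiff : U - frake 1 * W = ∑ l ∈ Finset.Ico 1 (D ^ 4), nu χ l / (l : ℂ) *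
      ∑ q ∈ l.divisorsAntidiagonal, nuOneStar c' χ q.2 *
        (inner q.1 - frake 1 * χ (q.1 : ZMod D) * (q.1.divisors.card : ℂ)) := by
    rw [hU', hW, Finset.mul_sum, ← Finset.sum_sub_distrib]
    refine Finset.sum_congr rfl fun l _ => ?_
    rw [← mul_assoc, mul_comm (frake 1) (nu χ l / (l : ℂ)), mul_assoc, ← mul_sub, Finset.mul_sum,
      ← Finset.sum_sub_distrib]
    congr 1
    refine Finset.sum_congr rfl fun q _ => ?_
    ring
  have hbound : ‖U - frake 1 * W‖ ≤ C * alpha D * ell D * E := by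
    rw [hdiff]
    refine (norm_sum_le _ _).trans ?_
    rw [hEdef, Finset.mul_sum]
    refine Finset.sum_le_sum fun l hl => ?_
    rw [norm_mul, norm_div, Complex.norm_natCast]
    have hl0 : (0 : ℝ) ≤ ‖nu χ l‖ / (l : ℝ) := by positivity
    rw [mul_comm (C * alpha D * ell D), mul_assoc]
    refine mul_le_mul_of_nonneg_left ?_ hl0
    refine (norm_sum_le _ _).trans ?_
    rw [Finset.sum_mul]
    refine Finset.sum_le_sum fun q hq => ?_
    have hl' := Finset.mem_Ico.1 hl
    have hq' := Nat.mem_divisorsAntidiagonal.1 hq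
    have hq1dvd : q.1 ∣ l := ⟨q.2, hq'.1.symm⟩
    have hq1pos : 0 < q.1 := Nat.pos_of_ne_zero fun h0 => hq'.2 (by rw [← hq'.1, h0, zero_mul])
    have hq1 : 1 ≤ q.1 := hq1pos
    have hq4 : q.1 < D ^ 4 := lt_of_le_of_lt (Nat.le_of_dvd (by omega) hq1dvd) hl'.2
    rw [norm_mul]
    have h23q := e23 q.1 hq1 hq4
    calc ‖nuOneStar c' χ q.2‖ * ‖inner q.1 - frake 1 * χ (q.1 : ZMod D) * (q.1.divisors.card : ℂ)‖
        ≤ ‖nuOneStar c' χ q.2‖ * (C * alpha D * ell D * q.1.divisors.card) :=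
          mul_le_mul_of_nonneg_left h23q (norm_nonneg _)
      _ = (q.1.divisors.card : ℝ) * ‖nuOneStar c' χ q.2‖ * (C * alpha D * ell D) := by ring
  -- sizes
  have hℓ : 0 ≤ ell D := Real.log_natCast_nonneg D
  have hα : 0 ≤ alpha D := by
    rw [alpha, bigP, Real.log_exp]; exact div_nonneg Real.pi_pos.le (pow_nonneg hℓ 9)
  have hE0 : 0 ≤ E := Finset.sum_nonneg fun l _ => mul_nonneg (by positivity)
    (Finset.sum_nonneg fun q _ => by positivity)
  have hαℓE : 0 ≤ alpha D * ell D * E := mul_nonneg (mul_nonneg hα hℓ) hE0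
  have hCE : C * alpha D * ell D * E ≤ ε / 2 := by
    calc C * alpha D * ell D * E = C * (alpha D * ell D * E) := by ring
      _ ≤ |C| * (alpha D * ell D * E) := mul_le_mul_of_nonneg_right (le_abs_self C) hαℓE
      _ ≤ |C| * (ε / 2 / (|C| + 1)) := mul_le_mul_of_nonneg_left eE (abs_nonneg C)
      _ ≤ ε / 2 := by
          rw [mul_div_assoc', div_le_iff₀ (by positivity)]
          nlinarith [abs_nonneg C]
  have hsplit : V - frake 1 * W = (V - U) + (U - frake 1 * W) := by ring
  show ‖V - frake 1 * W‖ ≤ ε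
  rw [hsplit]
  calc ‖(V - U) + (U - frake 1 * W)‖ ≤ ‖V - U‖ + ‖U - frake 1 * W‖ := norm_add_le _ _
    _ ≤ ε / 2 + C * alpha D * ell D * E := add_le_add e21 hbound
    _ ≤ ε / 2 + ε / 2 := by linarith
    _ = ε := by ring

/-! ## §3. u026, (17.9) and the leaf (17.9)ᴿ from the χ-parts -/

/-- **§17.u026 from (17.8)-χ, u024-χ and u025** (typed node `Step17_u026 c′` BY NAME; the tree's
`step17_u026_of` re-run with `V_χ`): `Φ₃⁻(p) = pV_χ + o(p)` uniformly in `p ∼ P`, `V_χ = 𝔢₁W + o(1)`,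
`𝔢₁W = 𝔢₁Σν²/l + o(1) = 𝔢₁𝔞 + o(1)`. [cite: Zhang2022LandauSiegel, §17 u026 p.98] -/
theorem step17_u026_of_chi {c' : ℝ}
    (h8 : ∀ ε : ℝ, 0 < ε → ForAllLarge fun D _ χ => AssumptionA D χ → ∀ p ∈ primeWindow D,
      ‖Phi3minus c' χ p - (p : ℂ) *
          ∑' n : ℕ, LSeries.convolution (fun n => bcoef D n * χ (n : ZMod D)) (nuOneStar c' χ) n *
            varrho17 c' χ n / (n : ℂ)‖ ≤ ε * p)
    (h24 : ∀ ε : ℝ, 0 < ε → ForAllLarge fun D _ χ => AssumptionA D χ →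
      ‖(∑' n : ℕ, LSeries.convolution (fun n => bcoef D n * χ (n : ZMod D)) (nuOneStar c' χ) n *
            varrho17 c' χ n / (n : ℂ)) -
          frake 1 * ∑ l ∈ Finset.Ico 1 (D ^ 4), nu χ l / (l : ℂ) *
            ∑ q ∈ l.divisorsAntidiagonal,
              χ (q.1 : ZMod D) * (q.1.divisors.card : ℂ) * nuOneStar c' χ q.2‖ ≤ ε)
    (h25 : Step17_u025 c') : Step17_u026 c' := by
  intro ε hε
  have hε4 : 0 < ε / 4 := by positivity
  obtain ⟨D₀, h⟩ := ((h8 _ hε4).and (h24 _ hε4)).and (h25 _ hε4)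
  refine ⟨D₀, fun D _ χ hD hq hp hA p hpw => ?_⟩
  obtain ⟨⟨e8, e24⟩, e25⟩ := h D χ hD hq hp
  set V : ℂ := ∑' n : ℕ, LSeries.convolution (fun n => bcoef D n * χ (n : ZMod D)) (nuOneStar c' χ) n *
    varrho17 c' χ n / (n : ℂ) with hV
  set W : ℂ := ∑ l ∈ Finset.Ico 1 (D ^ 4), nu χ l / (l : ℂ) *
    ∑ q ∈ l.divisorsAntidiagonal, χ (q.1 : ZMod D) * (q.1.divisors.card : ℂ) * nuOneStar c' χ q.2
    with hW
  set R : ℂ := ∑ l ∈ Finset.Ico 1 (D ^ 4), nu χ l ^ 2 / (l : ℂ) with hR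
  have h1 : ‖Phi3minus c' χ p - (p : ℂ) * V‖ ≤ ε / 4 * p := e8 hA p hpw
  have h2 : ‖V - frake 1 * W‖ ≤ ε / 4 := e24 hA
  obtain ⟨h3, h4⟩ := e25 hA
  have hp0 : (0 : ℝ) ≤ p := Nat.cast_nonneg p
  have hV' : ‖V - frake 1 * frakA χ‖ ≤ 3 * (ε / 4) := by
    calc ‖V - frake 1 * frakA χ‖
        = ‖(V - frake 1 * W) + (frake 1 * W - frake 1 * R) + (frake 1 * R - frake 1 * frakA χ)‖ := by
          ring_nf
      _ ≤ ‖V - frake 1 * W‖ + ‖frake 1 * W - frake 1 * R‖ + ‖frake 1 * R - frake 1 * frakA χ‖ :=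
          (norm_add_le _ _).trans (add_le_add (norm_add_le _ _) le_rfl)
      _ ≤ ε / 4 + ε / 4 + ε / 4 := add_le_add (add_le_add h2 h3) h4
      _ = 3 * (ε / 4) := by ring
  calc ‖Phi3minus c' χ p - frake 1 * frakA χ * (p : ℂ)‖
      = ‖(Phi3minus c' χ p - (p : ℂ) * V) + (p : ℂ) * (V - frake 1 * frakA χ)‖ := by ring_nf
    _ ≤ ‖Phi3minus c' χ p - (p : ℂ) * V‖ + ‖(p : ℂ) * (V - frake 1 * frakA χ)‖ := norm_add_le _ _
    _ ≤ ε / 4 * p + p * (3 * (ε / 4)) := by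
        rw [norm_mul, Complex.norm_natCast]
        exact add_le_add h1 (mul_le_mul_of_nonneg_left hV' hp0)
    _ = ε * p := by ring

/-- **(17.9) from its χ-parts**: `Eq17_7 c′` + (17.8)-χ + u021-χ + `Lemma151Chi c′` ⇒ `Eq17_9 c′` (tree
edges `eq17_9_of`, `step17_u026_of_chi`, `step17_u024Chi_of`, and the theorem `step17_u025_holds`).
[cite: Zhang2022LandauSiegel, §17 (17.9) p.98] -/
theorem eq17_9_of_partsChi (c' : ℝ) (h7 : Eq17_7 c')
    (h8 : ∀ ε : ℝ, 0 < ε → ForAllLarge fun D _ χ => AssumptionA D χ → ∀ p ∈ primeWindow D,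
      ‖Phi3minus c' χ p - (p : ℂ) *
          ∑' n : ℕ, LSeries.convolution (fun n => bcoef D n * χ (n : ZMod D)) (nuOneStar c' χ) n *
            varrho17 c' χ n / (n : ℂ)‖ ≤ ε * p)
    (h21 : ∀ ε : ℝ, 0 < ε → ForAllLarge fun D _ χ => AssumptionA D χ →
      ‖(∑' n : ℕ, LSeries.convolution (fun n => bcoef D n * χ (n : ZMod D)) (nuOneStar c' χ) n *
            varrho17 c' χ n / (n : ℂ)) -
          ∑ l ∈ Finset.Ico 1 (D ^ 4), nu χ l / (l : ℂ) *
            ∑ q ∈ l.divisorsAntidiagonal, ∑' m₁ : ℕ,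
              if Nat.Coprime m₁ (frakq D) then
                bcoef D (q.1 * m₁) * χ ((q.1 * m₁ : ℕ) : ZMod D) * nuOneStar c' χ q.2 *
                  kappa2bar c' D m₁ / (m₁ : ℂ)
              else 0‖ ≤ ε)
    (h151 : Lemma151Chi c') : Eq17_9 c' :=
  eq17_9_of h7 (step17_u026_of_chi h8 (step17_u024Chi_of c' h21 h151) (step17_u025_holds c'))

/-- **The v19 leaf `Eq17_9Rel c′` from its χ-parts**: `Eq17_7 c′` + (17.8)-χ + u021-χ +
`Lemma151Chi c′` ⇒ `Typed.Section17.Eq17_9Rel c′` BY NAME (absolute route: `eq17_9_of_partsChi` then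
`eq17_9Rel_of_eq17_9`). [cite: Zhang2022LandauSiegel, §17 (17.9) p.98] -/
theorem eq17_9Rel_of_partsChi (c' : ℝ) (h7 : Eq17_7 c')
    (h8 : ∀ ε : ℝ, 0 < ε → ForAllLarge fun D _ χ => AssumptionA D χ → ∀ p ∈ primeWindow D,
      ‖Phi3minus c' χ p - (p : ℂ) *
          ∑' n : ℕ, LSeries.convolution (fun n => bcoef D n * χ (n : ZMod D)) (nuOneStar c' χ) n *
            varrho17 c' χ n / (n : ℂ)‖ ≤ ε * p)
    (h21 : ∀ ε : ℝ, 0 < ε → ForAllLarge fun D _ χ => AssumptionA D χ →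
      ‖(∑' n : ℕ, LSeries.convolution (fun n => bcoef D n * χ (n : ZMod D)) (nuOneStar c' χ) n *
            varrho17 c' χ n / (n : ℂ)) -
          ∑ l ∈ Finset.Ico 1 (D ^ 4), nu χ l / (l : ℂ) *
            ∑ q ∈ l.divisorsAntidiagonal, ∑' m₁ : ℕ,
              if Nat.Coprime m₁ (frakq D) then
                bcoef D (q.1 * m₁) * χ ((q.1 * m₁ : ℕ) : ZMod D) * nuOneStar c' χ q.2 *
                  kappa2bar c' D m₁ / (m₁ : ℂ)
              else 0‖ ≤ ε)
    (h151 : Lemma151Chi c') : Eq17_9Rel c' :=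
  (eq17_9Rel_iff c').mpr (eq17_9Rel_of_eq17_9 (eq17_9_of_partsChi c' h7 h8 h21 h151))

/-! ## §4. The relative-budget signatures of the planner's sketch (WP16-PLAN S4), as corollaries -/

/-- u024-χ in the relative budget `ε(𝔞+1)` (the sketch's `step17_u024ChiRel_of_lemma151Chi`), a
corollary of the absolute `step17_u024Chi_of` (`ε ≤ ε(𝔞+1)`). [cite: Zhang2022LandauSiegel, §17 u024 p.98] -/
theorem step17_u024ChiRel_of_lemma151Chi (c' : ℝ)
    (h21 : ∀ ε : ℝ, 0 < ε → ForAllLarge fun D _ χ => AssumptionA D χ →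
      ‖(∑' n : ℕ, LSeries.convolution (fun n => bcoef D n * χ (n : ZMod D)) (nuOneStar c' χ) n *
            varrho17 c' χ n / (n : ℂ)) -
          ∑ l ∈ Finset.Ico 1 (D ^ 4), nu χ l / (l : ℂ) *
            ∑ q ∈ l.divisorsAntidiagonal, ∑' m₁ : ℕ,
              if Nat.Coprime m₁ (frakq D) then
                bcoef D (q.1 * m₁) * χ ((q.1 * m₁ : ℕ) : ZMod D) * nuOneStar c' χ q.2 *
                  kappa2bar c' D m₁ / (m₁ : ℂ)
              else 0‖ ≤ ε)
    (h151 : Lemma151Chi c') :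
    ∀ ε : ℝ, 0 < ε → ForAllLarge fun D _ χ => AssumptionA D χ →
      ‖(∑' n : ℕ, LSeries.convolution (fun n => bcoef D n * χ (n : ZMod D)) (nuOneStar c' χ) n *
            varrho17 c' χ n / (n : ℂ)) -
          frake 1 * ∑ l ∈ Finset.Ico 1 (D ^ 4), nu χ l / (l : ℂ) *
            ∑ q ∈ l.divisorsAntidiagonal,
              χ (q.1 : ZMod D) * (q.1.divisors.card : ℂ) * nuOneStar c' χ q.2‖ ≤
        ε * (frakA χ + 1) := fun ε hε =>
  (step17_u024Chi_of c' h21 h151 ε hε).mono fun D _ χ _ _ h hA => by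
    have e := h hA
    have hA0 : 0 ≤ frakA χ := frakA_nonneg χ
    nlinarith

/-- (17.9)ᴿ from (17.7), (17.8)-χ, u024-χ in the relative budget and `Step17_u025` (the sketch's
`eq17_9Rel_of_partsChiRel`): the relative window bookkeeping, written out (no `𝔞 ≪ 𝓛⁴` input: the
relative error `ε(𝔞+1)p` per modulus sums to `ε(𝔞+1)𝔓`, and `(pt₀)^{β₂} = 1 + O(α𝓛)` costs
`O(α𝓛)·|𝔢₁|𝔞𝔓 ≤ ε𝔞𝔓` eventually). [cite: Zhang2022LandauSiegel, §17 (17.8)–(17.9) p.98] -/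
theorem eq17_9Rel_of_partsChiRel (c' : ℝ) (h7 : Eq17_7 c')
    (h8 : ∀ ε : ℝ, 0 < ε → ForAllLarge fun D _ χ => AssumptionA D χ → ∀ p ∈ primeWindow D,
      ‖Phi3minus c' χ p - (p : ℂ) *
          ∑' n : ℕ, LSeries.convolution (fun n => bcoef D n * χ (n : ZMod D)) (nuOneStar c' χ) n *
            varrho17 c' χ n / (n : ℂ)‖ ≤ ε * p)
    (h24 : ∀ ε : ℝ, 0 < ε → ForAllLarge fun D _ χ => AssumptionA D χ →
      ‖(∑' n : ℕ, LSeries.convolution (fun n => bcoef D n * χ (n : ZMod D)) (nuOneStar c' χ) n *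
            varrho17 c' χ n / (n : ℂ)) -
          frake 1 * ∑ l ∈ Finset.Ico 1 (D ^ 4), nu χ l / (l : ℂ) *
            ∑ q ∈ l.divisorsAntidiagonal,
              χ (q.1 : ZMod D) * (q.1.divisors.card : ℂ) * nuOneStar c' χ q.2‖ ≤
        ε * (frakA χ + 1))
    (h25 : Step17_u025 c') : Eq17_9Rel c' := by
  -- u026 in the relative budget, uniformly in `p ∼ P`
  have h26 : ∀ ε : ℝ, 0 < ε → ForAllLarge fun D _ χ => AssumptionA D χ → ∀ p ∈ primeWindow D,
      ‖Phi3minus c' χ p - frake 1 * frakA χ * (p : ℂ)‖ ≤ ε * (frakA χ + 1) * p := by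
    intro ε hε
    have hε4 : 0 < ε / 4 := by positivity
    obtain ⟨D₀, h⟩ := ((h8 _ hε4).and (h24 _ hε4)).and (h25 _ hε4)
    refine ⟨D₀, fun D _ χ hD hq hp hA p hpw => ?_⟩
    obtain ⟨⟨e8, e24⟩, e25⟩ := h D χ hD hq hp
    set V : ℂ := ∑' n : ℕ, LSeries.convolution (fun n => bcoef D n * χ (n : ZMod D))
      (nuOneStar c' χ) n * varrho17 c' χ n / (n : ℂ) with hV
    set W : ℂ := ∑ l ∈ Finset.Ico 1 (D ^ 4), nu χ l / (l : ℂ) *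
      ∑ q ∈ l.divisorsAntidiagonal, χ (q.1 : ZMod D) * (q.1.divisors.card : ℂ) * nuOneStar c' χ q.2
      with hW
    set R : ℂ := ∑ l ∈ Finset.Ico 1 (D ^ 4), nu χ l ^ 2 / (l : ℂ) with hR
    have hA0 : 0 ≤ frakA χ := frakA_nonneg χ
    have hA1 : 1 ≤ frakA χ + 1 := by linarith
    have h1 : ‖Phi3minus c' χ p - (p : ℂ) * V‖ ≤ ε / 4 * p := e8 hA p hpw
    have h2 : ‖V - frake 1 * W‖ ≤ ε / 4 * (frakA χ + 1) := e24 hA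
    obtain ⟨h3, h4⟩ := e25 hA
    have hp0 : (0 : ℝ) ≤ p := Nat.cast_nonneg p
    have hV' : ‖V - frake 1 * frakA χ‖ ≤ 3 * (ε / 4) * (frakA χ + 1) := by
      calc ‖V - frake 1 * frakA χ‖
          = ‖(V - frake 1 * W) + (frake 1 * W - frake 1 * R) + (frake 1 * R - frake 1 * frakA χ)‖ := by
            ring_nf
        _ ≤ ‖V - frake 1 * W‖ + ‖frake 1 * W - frake 1 * R‖ + ‖frake 1 * R - frake 1 * frakA χ‖ :=
            (norm_add_le _ _).trans (add_le_add (norm_add_le _ _) le_rfl)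
        _ ≤ ε / 4 * (frakA χ + 1) + ε / 4 + ε / 4 := add_le_add (add_le_add h2 h3) h4
        _ ≤ 3 * (ε / 4) * (frakA χ + 1) := by nlinarith
    calc ‖Phi3minus c' χ p - frake 1 * frakA χ * (p : ℂ)‖
        = ‖(Phi3minus c' χ p - (p : ℂ) * V) + (p : ℂ) * (V - frake 1 * frakA χ)‖ := by ring_nf
      _ ≤ ‖Phi3minus c' χ p - (p : ℂ) * V‖ + ‖(p : ℂ) * (V - frake 1 * frakA χ)‖ := norm_add_le _ _
      _ ≤ ε / 4 * p + p * (3 * (ε / 4) * (frakA χ + 1)) := by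
          rw [norm_mul, Complex.norm_natCast]
          exact add_le_add h1 (mul_le_mul_of_nonneg_left hV' hp0)
      _ ≤ ε * (frakA χ + 1) * p := by
          have h14 : ε / 4 * p ≤ ε / 4 * p * (frakA χ + 1) :=
            le_mul_of_one_le_right (by positivity) hA1
          nlinarith
  -- the window sum with the relative per-modulus error (`Skeleton.window_sum_evalRel_beta2`)
  have hΦ : ∀ ε : ℝ, 0 < ε → ForAllLarge fun D _ χ => AssumptionA D χ → ∀ p ∈ primeWindow D,
      ‖(fun D χ p => Phi3minus c' χ p) D χ p - frake 1 * p *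
        (fun D χ => if h : D = 0 then (0 : ℂ) else ((@frakA D ⟨h⟩ χ : ℝ) : ℂ)) D χ‖ ≤
          ε * (frakA χ + 1) * p := by
    intro ε hε
    refine (h26 ε hε).mono fun D _ χ _ _ h hA p hp => ?_
    have e := h hA p hp
    beta_reduce
    rw [dif_neg (NeZero.ne D)]
    rwa [show frake 1 * (frakA χ : ℂ) * (p : ℂ) = frake 1 * (p : ℂ) * (frakA χ : ℂ) by ring] at e
  have hX : ∀ δ : ℝ, 0 < δ → ForAllLarge fun D _ χ => AssumptionA D χ →
      ‖(fun D χ => if h : D = 0 then (0 : ℂ) else ((@frakA D ⟨h⟩ χ : ℝ) : ℂ)) D χ - frakA χ‖ ≤ δ := by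
    intro δ hδ
    refine ⟨1, fun D _ χ _ _ _ _ => ?_⟩
    beta_reduce
    rw [dif_neg (NeZero.ne D), sub_self, norm_zero]
    exact hδ.le
  have key := window_sum_evalRel_beta2 c' (c := frake 1) hΦ hX
  intro ε hε
  have hε2 : 0 < ε / 2 := by positivity
  refine ((h7 _ hε2).and (key _ hε2)).mono fun D _ χ _ _ h hA => ?_
  obtain ⟨e7, e9⟩ := h
  have a := e7 hA
  have b := e9 hA
  beta_reduce at b
  have hA0 : 0 ≤ frakA χ := frakA_nonneg χ
  have hPnn : 0 ≤ frakP D := frakP_nonneg D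
  set Xm : ℂ := ∑ x ∈ finsetOf (PsiOne χ),
    (((x.p : ℝ) * t0 D : ℝ) : ℂ) ^ beta3 c' D * I4 c' χ x (-alpha D) with hXm
  set Y : ℂ := ∑ p ∈ primeWindow D, (((p : ℝ) * t0 D : ℝ) : ℂ) ^ beta2 c' D * Phi3minus c' χ p
    with hY
  calc ‖Xm - frake 1 * frakA χ * frakP D‖
      = ‖(Xm - Y) + (Y - frake 1 * frakA χ * frakP D)‖ := by ring_nf
    _ ≤ ‖Xm - Y‖ + ‖Y - frake 1 * frakA χ * frakP D‖ := norm_add_le _ _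
    _ ≤ ε / 2 * frakP D + ε / 2 * (frakA χ + 1) * frakP D := add_le_add a b
    _ ≤ ε * (frakA χ + 1) * frakP D := by nlinarith [mul_nonneg hA0 hPnn]

/-! ## §5. On the typed χ-nodes of record (`TypedSection17RelE`: `Eq17_8Chi`, `Step17_u021Chi`) -/

/-- **The v19 leaf from the typed χ-nodes of record**: `Eq17_7 c′ → Eq17_8Chi c′ → Step17_u021Chi c′ →
Skeleton.Lemma151Chi c′ → Eq17_9Rel c′` (the inline hypotheses of `eq17_9Rel_of_partsChi` ARE these nodes).
[cite: Zhang2022LandauSiegel, §17 (17.9) p.98] -/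
theorem eq17_9Rel_of_chiNodes (c' : ℝ) (h7 : Eq17_7 c') (h8 : Eq17_8Chi c') (h21 : Step17_u021Chi c')
    (h151 : Lemma151Chi c') : Eq17_9Rel c' :=
  eq17_9Rel_of_partsChi c' h7 h8 h21 h151

/-- `Eq17_9 c′` (absolute (17.9)) from the same typed χ-nodes. [cite: Zhang2022LandauSiegel, §17 (17.9) p.98] -/
theorem eq17_9_of_chiNodes (c' : ℝ) (h7 : Eq17_7 c') (h8 : Eq17_8Chi c') (h21 : Step17_u021Chi c')
    (h151 : Lemma151Chi c') : Eq17_9 c' :=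
  eq17_9_of_partsChi c' h7 h8 h21 h151

/-- `Step17_u026 c′` from `Eq17_8Chi`, `Step17_u021Chi` and `Lemma151Chi` (u025 is the tree theorem
`step17_u025_holds`). [cite: Zhang2022LandauSiegel, §17 u026 p.98] -/
theorem step17_u026_of_chiNodes (c' : ℝ) (h8 : Eq17_8Chi c') (h21 : Step17_u021Chi c')
    (h151 : Lemma151Chi c') : Step17_u026 c' :=
  step17_u026_of_chi h8 (step17_u024Chi_of c' h21 h151) (step17_u025_holds c')

end Literature.NumberTheory.LFunctions.Zhang2022.Phi3Eval
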